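import Summits.ResolutionOfSingularities.ResolutionOfSingularities.Theorems.HilbertSamuelEliminationSigmaMaxModificationsCorridor3WLadderStrataFibre
import Literature.AlgebraicGeometry.CossartJannsenSaito2020.NearPointDirectrix
import Literature.AlgebraicGeometry.Resolution.SncStrata
import Literature.AlgebraicGeometry.Resolution.StalkIdealGenerization
import Mathlib.RingTheory.KrullDimension.NonZeroDivisors
import HarnessLib

/-!
# [OURS · L1 W4.2] The STRATA-half of the MOVING W-ladder, sixth layer: the CENTRE-IS-A-CURVE row (b-curve) CLOSED from
# CJS Thm. 3.14 (numerical form, named fact `CossartJannsenSaito2020_thm_3_14`, p499700) — the dimension translation, PROVED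

Crux chain w42 (`SigmaMaxModifications`, stmt-ResolutionOfSingularities-18506; skeleton `w_ladder` v5b on
`SigmaMaxModificationsCorridor3`, stmt-ResolutionOfSingularities-19249), row «stub-4 → `Moving.Wlow3CharStrataM p`», seat
res-L1-w42-stub-4 (gen 3); companion of p500484 / p503069 / p503885 / p504439 / p505314 / p506465 / p508074 / p508693 / p510273.
OURS (cell res-hironaka, slot W4.2); NOT statements of H. Hironaka's manuscript [Hironaka2017] nor of [CossartJannsenSaito2020];
AI-drafted, weaker than expert review. Every `theorem` is PROVED; CONDITIONAL on the printed fact CJS Thm. 3.14 taken BY NAME as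
the hypothesis `(h314 : CossartJannsenSaito2020_thm_3_14)` (res-type-066, p499700; print-faithful with `CharHypothesis`). Helper file
`--supports stmt-ResolutionOfSingularities-19249`.

## What is proved

* §1 `two_le_ringKrullDim_quotient_stalkIdeal` — **the dimension translation**: a strict chain of generisations
  `η ⤳ a ⤳ x` inside the support of an ideal sheaf `I` gives three primes `𝔭_η < 𝔭_a < 𝔪_x` of `𝒪_{X,x}` containing `I_x`
  (tree `primeOfSpecializes`, `specializes_of_primeOfSpecializes_le`, `mem_support_iff_stalkIdeal_le_primeOfSpecializes`), hence
  `2 ≤ dim (𝒪_{X,x}/I_x)` (Mathlib `ringKrullDim_quotient`: `Spec(R/I) ≅ Z(I)`).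
* §2 `strataCentreCurveAt_of_thm_3_14 : CossartJannsenSaito2020_thm_3_14 → ∀ p, StrataCentreCurveAt p 3 (QNe (QCharRegime p))
  (ē ≤ 2)` — **row (b-curve) of p510273 CLOSED in the (F1) regime**: at a blown-up step of a chain from a maximal origin with
  `ν ≠ Φ^{(3)}` the canonical centre `C ∋ x_n` is permissible (s42's `StateGood`, res-L1-w42-stub-2's `stateGood_of_reaches`),
  `x_{n+1}` is near `x_n`, and `CharHypothesis X_n x_n` holds (stub-2's `charHypothesis_of_qCharRegime`); Thm. 3.14 gives
  `dim 𝒪_{C,x_n} < e_{x_n} ≤ ē_{x_n} ≤ 2`, so no irreducible closed `A` lies strictly between `{x_n}` and a component of `V(C)`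
  (§1 with the generic points of `A` and of the component).
* §3 the strata-half with (b-curve) discharged: `wlow3CharStrataM_of_thm_3_14_fibre_centreIO_cycleStartRegular :
  CossartJannsenSaito2020_thm_3_14 → (b-fib) → (c-geo) → (c-reg) → Wlow3CharStrataM p`.

References: CJS LNM 2270 Thm. 3.14, Def. 3.1, Lemma 3.15, Rem. 6.29 (1) [CossartJannsenSaito2020]; Stacks 01J7 (generisations =
primes of the local ring) [StacksProject]; tree `…NearPointDirectrix` (p499700), `…Corridor3WLadderGradeZero` (stub-2: `stateGood_of_reaches`,
`charHypothesis_of_qCharRegime`), `Literature…StrictNormalCrossingsFlatDescent` / `…SncStrata` / `…StalkIdealGenerization`.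
-/

noncomputable section

-- plan-1/idea-2 module setting kept (namespace `…Corridor3.Moving` re-enters `…Corridor3`)
set_option linter.dupNamespace false

open CategoryTheory AlgebraicGeometry TopologicalSpace Topology IsLocalRing
open Summit.ResolutionOfSingularities.ResolutionOfSingularities.Theorems.CampaignW42
open Literature.AlgebraicGeometry.Resolution Literature.RingTheory.HilbertSamuel
open Literature.AlgebraicGeometry.CossartJannsenSaito2020
open Summit.ResolutionOfSingularities.ResolutionOfSingularities.Theorems.SigmaMaxModificationsCorridor3

universe u

namespace Summit.ResolutionOfSingularities.ResolutionOfSingularities.Theorems.SigmaMaxModificationsCorridor3.Moving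

variable {R : ∀ S : Scheme.{u}, CentreSeq S → Prop} {N : ℕ} {ν : ℕ → ℕ}

/-! ## §1. The dimension translation: a strict chain of generisations in `V(I)` gives `dim 𝒪_{X,x}/I_x ≥ 2` -/

/-- **A strict chain of generisations `η ⤳ a ⤳ x` inside the support of the ideal sheaf `I` forces
`2 ≤ dim (𝒪_{X,x} / I_x)`**: the primes `𝔭_η < 𝔭_a < 𝔪_x` of `𝒪_{X,x}` all contain `I_x`. [cite: StacksProject, Tag 01J7] -/
theorem two_le_ringKrullDim_quotient_stalkIdeal {X : Scheme.{u}} (I : X.IdealSheafData) {x a η : X} (hax : a ⤳ x)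
    (hηa : η ⤳ a) (hne₁ : a ≠ x) (hne₂ : η ≠ a) (hηI : η ∈ I.support) (haI : a ∈ I.support) :
    (2 : WithBot ℕ∞) ≤ ringKrullDim (X.presheaf.stalk x ⧸ stalkIdeal I x) := by
  rw [ringKrullDim_quotient]
  -- the three primes
  haveI h₁p : (primeOfSpecializes hax).IsPrime := Ideal.IsPrime.comap _
  haveI h₂p : (primeOfSpecializes (hηa.trans hax)).IsPrime := Ideal.IsPrime.comap _
  have h₂₁ : primeOfSpecializes (hηa.trans hax) ≤ primeOfSpecializes hax := primeOfSpecializes_mono hax hηa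
  have h₁₀ : primeOfSpecializes hax ≤ maximalIdeal (X.presheaf.stalk x) := le_maximalIdeal h₁p.ne_top
  have hne₂₁ : primeOfSpecializes (hηa.trans hax) ≠ primeOfSpecializes hax := fun h =>
    hne₂ (hηa.antisymm (specializes_of_primeOfSpecializes_le (hηa.trans hax) hax h.symm.le)).eq
  have hne₁₀ : primeOfSpecializes hax ≠ maximalIdeal (X.presheaf.stalk x) := fun h =>
    hne₁ (hax.antisymm (specializes_of_primeOfSpecializes_le hax (specializes_refl x)
      (by rw [Literature.AlgebraicGeometry.Resolution.primeOfSpecializes_refl]; exact h.symm.le))).eq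
  -- all three contain `I_x`
  have hJ₂ : stalkIdeal I x ≤ primeOfSpecializes (hηa.trans hax) :=
    (mem_support_iff_stalkIdeal_le_primeOfSpecializes (hηa.trans hax) I).mp hηI
  have hJ₁ : stalkIdeal I x ≤ primeOfSpecializes hax := (mem_support_iff_stalkIdeal_le_primeOfSpecializes hax I).mp haI
  have hJ₀ : stalkIdeal I x ≤ maximalIdeal (X.presheaf.stalk x) := hJ₁.trans h₁₀
  -- as points of the zero locus `Z(I_x) ⊆ Spec 𝒪_{X,x}`
  let q₂ : ↥(PrimeSpectrum.zeroLocus (R := X.presheaf.stalk x) (stalkIdeal I x : Set (X.presheaf.stalk x))) :=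
    ⟨⟨primeOfSpecializes (hηa.trans hax), h₂p⟩, by
      rw [PrimeSpectrum.mem_zeroLocus, SetLike.coe_subset_coe]; exact hJ₂⟩
  let q₁ : ↥(PrimeSpectrum.zeroLocus (R := X.presheaf.stalk x) (stalkIdeal I x : Set (X.presheaf.stalk x))) :=
    ⟨⟨primeOfSpecializes hax, h₁p⟩, by
      rw [PrimeSpectrum.mem_zeroLocus, SetLike.coe_subset_coe]; exact hJ₁⟩
  let q₀ : ↥(PrimeSpectrum.zeroLocus (R := X.presheaf.stalk x) (stalkIdeal I x : Set (X.presheaf.stalk x))) :=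
    ⟨⟨maximalIdeal _, (maximalIdeal.isMaximal _).isPrime⟩, by
      rw [PrimeSpectrum.mem_zeroLocus, SetLike.coe_subset_coe]; exact hJ₀⟩
  have hlt₂₁ : q₂ < q₁ := lt_of_le_of_ne h₂₁ fun h => hne₂₁ (by
    have := congrArg (fun q : ↥(PrimeSpectrum.zeroLocus (R := X.presheaf.stalk x)
      (stalkIdeal I x : Set (X.presheaf.stalk x))) => q.1.asIdeal) h
    exact this)
  have hlt₁₀ : q₁ < q₀ := lt_of_le_of_ne h₁₀ fun h => hne₁₀ (by
    have := congrArg (fun q : ↥(PrimeSpectrum.zeroLocus (R := X.presheaf.stalk x)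
      (stalkIdeal I x : Set (X.presheaf.stalk x))) => q.1.asIdeal) h
    exact this)
  -- a chain of length two
  let l : LTSeries ↥(PrimeSpectrum.zeroLocus (R := X.presheaf.stalk x) (stalkIdeal I x : Set (X.presheaf.stalk x))) :=
    LTSeries.mk 2 ![q₂, q₁, q₀] (Fin.strictMono_iff_lt_succ.mpr fun i => by
      fin_cases i
      · simpa using hlt₂₁
      · simpa using hlt₁₀)
  have hl : l.length = 2 := rfl
  have := Order.le_krullDim_iff.mpr ⟨l, hl⟩
  exact_mod_cast this

/-! ## §2. Row (b-curve) from CJS Thm. 3.14 in the (F1) regime -/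

/-- **ROW (b-curve) CLOSED (conditional on the printed Thm. 3.14, by name): in the (F1) regime `QCharRegime p`, with `ν ≠ Φ^{(3)}`
(`QNe`), along every chain from a maximal origin of characteristic `p` with `ē ≤ 2`, at EVERY blown-up step every irreducible
closed subset of the centre's support through the chain point is `{x_n}` or an irreducible component of the support.**
[cite: CossartJannsenSaito2020, Thm. 3.14, Def. 3.1, Rem. 6.29 (1)] -/
theorem strataCentreCurveAt_of_thm_3_14 (h314 : CossartJannsenSaito2020_thm_3_14.{u}) (p : ℕ) :
    StrataCentreCurveAt.{u} p 3 (QNe (Helpers.QCharRegime p)) fun s => s.geomDirDim ≤ 2 := by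
  intro R hRf hRa ν X _ x hX hQ c h0 hstep hG _ _
  refine ⟨0, fun n _ hbu _ C P' hcs A hAC hAirr hAcl hxA => ?_⟩
  obtain ⟨hq, hν⟩ := hQ
  -- the good state at stage `n` for the ground field of the origin, and (F1) at the chain point
  obtain ⟨k, _, _, f, -, hft, hqc⟩ := hX.exists_structure
  haveI := hft
  haveI := hqc
  haveI := hX.isReduced
  have hgood : StateGood k R 3 ν (c n).W (c n).L (c n).P :=
    stateGood_of_reaches (stateGood_init_general hRa f hX.dim_le hX.maximal hν) (reaches_chain h0 hstep n)
  have hchar : CharHypothesis (c n).W (c n).pt := charHypothesis_of_qCharRegime hX hq (reaches_chain h0 hstep n) hgood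
  haveI : IsLocallyNoetherian (c n).W := (c n).ln
  haveI : IsNoetherian (c n).W := hgood.isNoetherian
  have hpt : (c n).pt ∈ Scheme.hsStratum (c n).W 3 ν := pt_mem_hsStratum_of_reaches hX.mem_stratum (reaches_chain h0 hstep n)
  have hptcl : IsClosed ({(c n).pt} : Set (c n).W) := Reaches.isClosed_pt hX.isClosed (reaches_chain h0 hstep n)
  -- the chain point lies in the centre; the step data
  obtain ⟨C₁, P₁, hcs₁, hmem⟩ := hbu
  obtain rfl : C₁ = C := hcs₁.centre_unique hRf hcs
  obtain ⟨C₂, P₂, hln, x', hcs₂, hπ, -, hx', -⟩ := hstep n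
  obtain rfl : C₂ = C₁ := hcs₂.centre_unique hRf hcs₁
  haveI : IsLocallyNoetherian (blowup C₂) := hln
  -- Thm. 3.14: `dim 𝒪_{C,x_n} < e_{x_n} ≤ ē_{x_n} ≤ 2`
  have key := h314 (c n).W (blowup C₂) (blowup.π C₂) C₂ hgood.isExcellent (hgood.isPermissible hcs) (blowup.isBlowup C₂) 3
    hgood.dim_le x' (by rw [hπ]; exact hmem) (by rw [hπ]; exact hchar)
    (by rw [hπ, Scheme.mem_hsStratum_iff.mp hx', Scheme.mem_hsStratum_iff.mp hpt])
  rw [hπ] at key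
  have he2 : (Scheme.dirDim (c n).W (c n).pt : WithBot ℕ∞) ≤ 2 := by
    have h1 : Scheme.dirDim (c n).W (c n).pt ≤ 2 := (Scheme.dirDim_le_geomDirDim (c n).pt).trans (hG n)
    exact_mod_cast h1
  have hlt : ringKrullDim ((c n).W.presheaf.stalk (c n).pt ⧸ stalkIdeal C₂ (c n).pt) < 2 := key.trans_le he2
  -- topology: `A` between `{x_n}` and a component of `V(C)`
  refine or_iff_not_imp_left.mpr fun hne => ?_
  by_contra hnot
  obtain ⟨D₀, hD₀, hAD⟩ := exists_componentsIn_superset C₂.support.isClosed (componentsIn.finite _) hAirr hAC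
  have hAD' : A ≠ D₀ := fun h => hnot (h ▸ hD₀)
  have hD₀irr : IsIrreducible D₀ := componentsIn.isIrreducible hD₀
  have hD₀cl : IsClosed D₀ := componentsIn.isClosed C₂.support.isClosed hD₀
  have hAgen : IsGenericPoint hAirr.genericPoint A := hAirr.isGenericPoint_genericPoint hAcl
  have hDgen : IsGenericPoint hD₀irr.genericPoint D₀ := hD₀irr.isGenericPoint_genericPoint hD₀cl
  set a := hAirr.genericPoint with hadef
  set η := hD₀irr.genericPoint with hηdef
  have hax : a ⤳ (c n).pt := hAgen.specializes hxA
  have hηa : η ⤳ a := hDgen.specializes (hAD hAgen.mem)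
  have hne₁ : a ≠ (c n).pt := by
    intro h
    apply hne
    rw [← hAgen.def, h, hptcl.closure_eq]
  have hne₂ : η ≠ a := by
    intro h
    apply hAD'
    rw [← hAgen.def, ← hDgen.def, h]
  have hηI : η ∈ C₂.support := (componentsIn.subset hD₀) hDgen.mem
  have haI : a ∈ C₂.support := hAC hAgen.mem
  have h2 := two_le_ringKrullDim_quotient_stalkIdeal C₂ hax hηa hne₁ hne₂ hηI haI
  exact absurd (h2.trans_lt hlt) (lt_irrefl _)

/-! ## §3. The strata-half with (b-curve) discharged -/

/-- **`Wlow3CharStrataM p` (G1′) FROM THE PRINTED Thm. 3.14 (by name), (b-fib), (c-geo) AND (c-reg).**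
[cite: CossartJannsenSaito2020, Thm. 3.14, Thm. 6.35, Rem. 6.29 (1)] -/
theorem wlow3CharStrataM_of_thm_3_14_fibre_centreIO_cycleStartRegular {p : ℕ} (h314 : CossartJannsenSaito2020_thm_3_14.{0})
    (hfib : StrataNearFibreSubsingleton.{0} p 3 (QNe (Helpers.QCharRegime p)) fun s => s.geomDirDim ≤ 2)
    (hgeo : StrataLineageInCentreIO.{0} p 3 (QNe (Helpers.QCharRegime p)) fun s => s.geomDirDim ≤ 2)
    (hreg : StrataCycleStartRegular.{0} p 3 (QNe (Helpers.QCharRegime p)) fun s => s.geomDirDim ≤ 2) :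
    Wlow3CharStrataM p :=
  wlow3CharStrataM_of_fibre_curve_centreIO_cycleStartRegular hfib (strataCentreCurveAt_of_thm_3_14 h314 p) hgeo hreg

/-- … and the units/strata JOIN of the registered row: `Wlow3CharM p` from the F-key, the two units-half sockets, Thm. 3.14, (b-fib),
(c-geo), (c-reg). [cite: CossartJannsenSaito2020, Thm. 6.40, Cor. 6.37, Thm. 6.35, Thm. 3.14] -/
theorem wlow3CharM_of_extraction_thm_3_14_fibre_centreIO_cycleStartRegular {p : ℕ} (hK : KeyTheorem640_char_isolated.{0})
    (hlow : IsoLowDirDimTerminatesM p) (hext : UnitTowerExtractionQM p) (h314 : CossartJannsenSaito2020_thm_3_14.{0})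
    (hfib : StrataNearFibreSubsingleton.{0} p 3 (QNe (Helpers.QCharRegime p)) fun s => s.geomDirDim ≤ 2)
    (hgeo : StrataLineageInCentreIO.{0} p 3 (QNe (Helpers.QCharRegime p)) fun s => s.geomDirDim ≤ 2)
    (hreg : StrataCycleStartRegular.{0} p 3 (QNe (Helpers.QCharRegime p)) fun s => s.geomDirDim ≤ 2) : Wlow3CharM.{0} p :=
  wlow3CharM_assembled hK hlow hext (wlow3CharStrataM_of_thm_3_14_fibre_centreIO_cycleStartRegular h314 hfib hgeo hreg)

end Summit.ResolutionOfSingularities.ResolutionOfSingularities.Theorems.SigmaMaxModificationsCorridor3.Moving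

end
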